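import Summits.QuantumAdvantage.QuantumAdvantage.Theorems.SosSandwichQuerySecondLevelStep
import HarnessLib

/-!
# `Q_T`: the SECOND-HIGHEST Walsh level of a quantum acceptance probability obeys a DEGREE-FREE influence bound

Support theorem for route `SosSandwich`, crux `PseudoBoundedAA` (stmt-QuantumAdvantage-15237); Part 2 of the second
level (Part 1 = `SosSandwichQuerySecondLevelStep`; the top level = `SosSandwichQueryTopLevel{Step,Weight}` /
`SosSandwichQueryHomogeneousRung`, Escudero Gutiérrez Cor 1.7).

* `potential_step`, **`sum_norm_sq_gam_second_finalState_le`** — the TWO-CHAIN contraction argument: along a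
  `T`-query algorithm (`T ≥ 2`), with weights `c` on the `(2T−1)`-sets (`Σ_{U∋k}|c_U|² ≤ 1` for all `k`), the
  potential `Σ_{|R| = 2T−1−j} ‖Γ_j(R)‖² + Σ_{|R| = 2T−j} ‖Γ_j(R) − Γ¹_j(R)‖²` is non-increasing in `j ≥ 1`
  (`Γ = gam c (2T−1)`; `Γ¹` = the same functional of the auxiliary chain whose one "stay" move happened at the
  first query — a pure-add chain bounded by the top-level argument); hence `Σ_{|R| = T} ‖Γ_T(R)‖² ≤ 4`;
* `pairing_eq'` — `Σ_{|R|=T} ⟨Π v_R, Γ(R)⟩ = Σ_{|U|=T₂} c_U B(U)` for any size `T₂` (`B = topCoeff`).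
Part 3 (`SosSandwichQuerySecondLevelInfluence`) turns this into
`∃ i, (Σ_{|U| = 2T−1} p̂(U)²)² ≤ 4·Inf_i[p]` for every `T`-query algorithm with `T ≥ 2`.

Why this goes beyond the printed result: Escudero Gutiérrez's creation-operator proof handles the TOP level only and
Remark 4.3 (arXiv:2304.06713) records that it does not extend to lower levels of a general Fourier-completely-bounded
polynomial because indices repeat.  For GENUINE algorithms a Walsh coefficient ONE below the top is reached only by
words with exactly one "stay" move and no repeated index, and the stay move `P_+` is orthogonal to the add moves
`Δ_k` with `Σ_k ‖Δ_k x‖² + ‖P_+ x‖² = ‖x‖²` — so the contraction survives, up to the separate treatment of a stay at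
the very first query (the auxiliary chain).  Levels `≤ 2T − 2` involve "remove" moves (repeated indices) and are NOT
covered.  All proved, standard axioms.

Sources: EscuderoGutierrez2023 (arXiv:2304.06713) Thm 1.6, §4.2, Remark 4.3; BealsEtAl2001 Lemma 4.1; ODonnell2014 §1.4.
-/

noncomputable section

set_option linter.dupNamespace false

namespace Summit.QuantumAdvantage.QuantumAdvantage.Theorems.SosSandwich.QueryTopLevel

open Matrix Finset Literature.Computability.Cryptography Literature.Computability.QuantumComplexity
open Literature.Computability.Complexity.LowDegree Literature.Probability.RandomGraphs.LowDegree
open Summit.QuantumAdvantage.QuantumAdvantage.Theorems.SosSandwich.QueryFourier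
open scoped symmDiff

variable {N : ℕ} {W : Type*} [Fintype W]

/-! ### Small algebra -/

omit [Fintype W] in
/-- `Δ_k` is additive: `Δ_k (φ - ψ) = Δ_k φ - Δ_k ψ`. [folklore] -/
theorem blockDiff_sub' (k : Fin N) (φ ψ : Fin N × Bool × W → ℂ) :
    blockDiff k (φ - ψ) = blockDiff k φ - blockDiff k ψ := by
  funext x
  obtain ⟨k', b, w⟩ := x
  simp only [blockDiff_apply, Pi.sub_apply]
  split_ifs <;> ring

/-- `‖x‖² ≤ 2‖x − y‖² + 2‖y‖²` in sum-of-squares form. [folklore] -/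
theorem sum_norm_sq_le_two_mul (x y : Fin N × Bool × W → ℂ) :
    ∑ s, ‖x s‖ ^ 2 ≤ 2 * ∑ s, ‖(x - y) s‖ ^ 2 + 2 * ∑ s, ‖y s‖ ^ 2 := by
  rw [Finset.mul_sum, Finset.mul_sum, ← Finset.sum_add_distrib]
  refine Finset.sum_le_sum fun s _ => ?_
  have h : x s = (x - y) s + y s := by simp
  have htri : ‖x s‖ ≤ ‖(x - y) s‖ + ‖y s‖ := by
    rw [h]; exact (norm_add_le _ _).trans (by simp)
  nlinarith [norm_nonneg (x s), norm_nonneg ((x - y) s), norm_nonneg (y s),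
    sq_nonneg (‖(x - y) s‖ - ‖y s‖)]

omit [Fintype W] in
/-- A state of Walsh level `0` is constant, equal to its empty coefficient. [cite: ODonnell2014, §1.2] -/
theorem eq_const_of_level_zero {ψ : (Fin N → Bool) → Fin N × Bool × W → ℂ}
    (h : ∀ S : Finset (Fin N), 0 < S.card → vfc ψ S = 0) : ψ = fun _ => vfc ψ ∅ := by
  funext x
  funext s
  rw [← sum_vfc_mul_walsh ψ x s, Finset.sum_eq_single ∅]
  · simp [walsh_empty]
  · intro S _ hS
    rw [h S (Finset.card_pos.mpr (Finset.nonempty_iff_ne_empty.mpr hS))]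
    simp
  · simp

/-- **The pairing identity at size `T₂`**: `Σ_{|R| = T} ⟨Π v_R, Γ(R)⟩ = Σ_{|U| = T₂} c_U B(U)` with
`B(U) = topCoeff A U = Σ_{R ⊆ U, |R| = T} ⟨Π v_R, Π v_{U∖R}⟩` (any `T₂`). [cite: EscuderoGutierrez2023, §4.2] -/
theorem pairing_eq' (A : QQueryAlg N) (c : Finset (Fin N) → ℂ) (T₂ : ℕ) :
    ∑ R ∈ Finset.univ.filter (fun R : Finset (Fin N) => R.card = A.queries),
        star (accVfc A R) ⬝ᵥ gam c T₂ (fun x => A.finalState x) R =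
      ∑ U ∈ Finset.univ.filter (fun U : Finset (Fin N) => U.card = T₂), c U * topCoeff A U := by
  have e1 : ∀ R : Finset (Fin N), star (accVfc A R) ⬝ᵥ gam c T₂ (fun x => A.finalState x) R =
      ∑ U ∈ Finset.univ.filter (fun U : Finset (Fin N) => U.card = T₂ ∧ R ⊆ U),
        c U * (star (accVfc A R) ⬝ᵥ accVfc A (U \ R)) := by
    intro R
    unfold gam
    rw [dotProduct_sum]
    refine Finset.sum_congr rfl fun U _ => ?_
    rw [dotProduct_smul, smul_eq_mul, star_accVfc_dotProduct_vfc]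
  simp_rw [e1]
  rw [Finset.sum_comm' (t' := Finset.univ.filter (fun U : Finset (Fin N) => U.card = T₂))
    (s' := fun U => Finset.univ.filter (fun R : Finset (Fin N) => R.card = A.queries ∧ R ⊆ U))
    (h := fun R U => by simp only [Finset.mem_filter, Finset.mem_univ, true_and]; tauto)]
  refine Finset.sum_congr rfl fun U _ => ?_
  rw [topCoeff, Finset.mul_sum]

/-- **One potential step** (the heart of the second-level argument): for `Ψ` of level `≤ j`, `Φ` of level
`≤ j − 1` (`j ≥ 1`), a unitary `U` and `m + j = T₂`:
`Σ_{|R|=m−1… }` — precisely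
`Σ_{|R| = m-1} ‖Γ[UOΨ](R)‖² + Σ_{|R| = m} ‖Γ[UOΨ](R) − Γ[UOΦ](R)‖² ≤ Σ_{|R| = m} ‖Γ[Ψ](R)‖² + Σ_{|R| = m+1} ‖Γ[Ψ](R) − Γ[Φ](R)‖²`
(stated with `m = T₂ − j`). [cite: EscuderoGutierrez2023, §4.2] -/
theorem potential_step [DecidableEq W] (c : Finset (Fin N) → ℂ) {T₂ j : ℕ} (hj : 1 ≤ j) (hjT : j + 1 ≤ T₂)
    {Ψ Φ : (Fin N → Bool) → Fin N × Bool × W → ℂ}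
    (hΨ : ∀ S : Finset (Fin N), j < S.card → vfc Ψ S = 0)
    (hΦ : ∀ S : Finset (Fin N), j - 1 < S.card → vfc Φ S = 0)
    {U : Matrix (Fin N × Bool × W) (Fin N × Bool × W) ℂ} (hU : U ∈ Matrix.unitaryGroup (Fin N × Bool × W) ℂ) :
    (∑ R ∈ Finset.univ.filter (fun R : Finset (Fin N) => R.card = T₂ - (j + 1)),
        ∑ s, ‖gam c T₂ (fun x => U *ᵥ (queryOracle x *ᵥ Ψ x)) R s‖ ^ 2) +
      ∑ R ∈ Finset.univ.filter (fun R : Finset (Fin N) => R.card = T₂ - j),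
        ∑ s, ‖(gam c T₂ (fun x => U *ᵥ (queryOracle x *ᵥ Ψ x)) R -
              gam c T₂ (fun x => U *ᵥ (queryOracle x *ᵥ Φ x)) R) s‖ ^ 2 ≤
    (∑ R ∈ Finset.univ.filter (fun R : Finset (Fin N) => R.card = T₂ - j), ∑ s, ‖gam c T₂ Ψ R s‖ ^ 2) +
      ∑ R ∈ Finset.univ.filter (fun R : Finset (Fin N) => R.card = T₂ - j + 1),
        ∑ s, ‖(gam c T₂ Ψ R - gam c T₂ Φ R) s‖ ^ 2 := by
  -- the top part
  rw [sum_norm_sq_gam_step c hΨ hU (by omega : T₂ - (j + 1) + (j + 1) = T₂),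
    show T₂ - (j + 1) + 1 = T₂ - j from by omega]
  -- the difference part, termwise
  have ediff : ∀ R ∈ Finset.univ.filter (fun R : Finset (Fin N) => R.card = T₂ - j),
      ∑ s, ‖(gam c T₂ (fun x => U *ᵥ (queryOracle x *ᵥ Ψ x)) R -
            gam c T₂ (fun x => U *ᵥ (queryOracle x *ᵥ Φ x)) R) s‖ ^ 2 =
        ∑ s, ‖blockPlus (gam c T₂ Ψ R) s‖ ^ 2 +
          ∑ k ∈ Rᶜ, ∑ s, ‖blockDiff k (gam c T₂ Ψ (insert k R) - gam c T₂ Φ (insert k R)) s‖ ^ 2 := by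
    intro R hR
    rw [Finset.mem_filter] at hR
    rw [gam_step_second c hΨ U (by rw [hR.2]; omega),
      gam_step c hΦ U (show R.card + (j - 1 + 1) = T₂ by rw [hR.2]; omega), ← Matrix.mulVec_sub,
      sum_norm_sq_mulVec_of_mem_unitaryGroup hU, add_sub_assoc, ← Finset.sum_sub_distrib]
    simp_rw [← blockDiff_sub']
    exact norm_sq_blockPlus_add_sum_blockDiff _ _ _
  rw [Finset.sum_congr rfl ediff, Finset.sum_add_distrib,
    sum_card_sum_compl_insert (T₂ - j) (fun k R' => ∑ s, ‖blockDiff k (gam c T₂ Ψ R' - gam c T₂ Φ R') s‖ ^ 2)]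
  -- collect: `Σ_{k∈R} ‖Δ_k x‖² + ‖P_+ x‖² ≤ ‖x‖²` and `Σ_{k ∈ R'} ‖Δ_k y‖² ≤ ‖y‖²`
  have hA : ∀ R : Finset (Fin N), (∑ k ∈ R, ∑ s, ‖blockDiff k (gam c T₂ Ψ R) s‖ ^ 2) +
      ∑ s, ‖blockPlus (gam c T₂ Ψ R) s‖ ^ 2 ≤ ∑ s, ‖gam c T₂ Ψ R s‖ ^ 2 := by
    intro R
    rw [← sum_norm_sq_blockDiff_add_blockPlus (gam c T₂ Ψ R)]
    have hsub : ∑ k ∈ R, ∑ s, ‖blockDiff k (gam c T₂ Ψ R) s‖ ^ 2 ≤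
        ∑ k, ∑ s, ‖blockDiff k (gam c T₂ Ψ R) s‖ ^ 2 :=
      Finset.sum_le_sum_of_subset_of_nonneg (Finset.subset_univ R) fun k _ _ =>
        Finset.sum_nonneg fun s _ => by positivity
    linarith
  have hB : ∀ R' : Finset (Fin N), ∑ k ∈ R', ∑ s, ‖blockDiff k (gam c T₂ Ψ R' - gam c T₂ Φ R') s‖ ^ 2 ≤
      ∑ s, ‖(gam c T₂ Ψ R' - gam c T₂ Φ R') s‖ ^ 2 := by
    intro R'
    exact (Finset.sum_le_sum_of_subset_of_nonneg (Finset.subset_univ R') fun k _ _ =>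
      Finset.sum_nonneg fun s _ => by positivity).trans (sum_norm_sq_blockDiff_le _)
  have h1 := Finset.sum_le_sum (s := Finset.univ.filter (fun R : Finset (Fin N) => R.card = T₂ - j))
    fun R _ => hA R
  have h2 := Finset.sum_le_sum (s := Finset.univ.filter (fun R : Finset (Fin N) => R.card = T₂ - j + 1))
    fun R _ => hB R
  rw [Finset.sum_add_distrib] at h1
  linarith

/-- **The two-chain contraction argument for the second-highest level.**  For a `T`-query algorithm `A` with
`T ≥ 2` and weights `c` on the `(2T−1)`-subsets with `Σ_{U ∋ k} |c_U|² ≤ 1` for all `k`: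
`Σ_{|R| = T} ‖Γ[ψ](R)‖² ≤ 4` for the final state `ψ`, where `Γ = gam c (2T−1)` (one below the top).
[cite: EscuderoGutierrez2023, §4.2] -/
theorem sum_norm_sq_gam_second_finalState_le (A : QQueryAlg N) (hT : 2 ≤ A.queries) (c : Finset (Fin N) → ℂ)
    (hc : ∀ k : Fin N,
      ∑ U ∈ Finset.univ.filter (fun U : Finset (Fin N) => U.card = 2 * A.queries - 1 ∧ k ∈ U), ‖c U‖ ^ 2 ≤ 1) :
    ∑ R ∈ Finset.univ.filter (fun R : Finset (Fin N) => R.card = A.queries),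
      ∑ s, ‖gam c (2 * A.queries - 1) (fun x => A.finalState x) R s‖ ^ 2 ≤ 4 := by
  set T₂ := 2 * A.queries - 1 with hT₂
  let step : ((Fin N → Bool) → Fin N × Bool × A.W → ℂ) → Fin A.queries →
      ((Fin N → Bool) → Fin N × Bool × A.W → ℂ) :=
    fun Ψ j => fun b => (A.unitaries j.succ).1 *ᵥ (queryOracle b *ᵥ Ψ b)
  let u : Fin N × Bool × A.W → ℂ := (A.unitaries 0).1 *ᵥ Pi.single A.start 1
  let init : (Fin N → Bool) → Fin N × Bool × A.W → ℂ := fun _ => u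
  have h1T : 1 < A.queries := hT
  let u1 : Fin N × Bool × A.W → ℂ := (A.unitaries (Fin.succ ⟨0, by omega⟩)).1 *ᵥ blockPlus u
  -- the auxiliary chain (stay at the first query, then the true steps): `auxm m` = its state at time `m + 1`
  let auxm : ℕ → ((Fin N → Bool) → Fin N × Bool × A.W → ℂ) := fun m =>
    Nat.rec (motive := fun _ => (Fin N → Bool) → Fin N × Bool × A.W → ℂ) (fun _ => u1)
      (fun m Φ => if h : m + 1 < A.queries then step Φ ⟨m + 1, h⟩ else Φ) m
  have auxm_zero : auxm 0 = fun _ => u1 := rfl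
  have auxm_succ : ∀ (m : ℕ) (h : m + 1 < A.queries), auxm (m + 1) = step (auxm m) ⟨m + 1, h⟩ := by
    intro m h
    show (if h : m + 1 < A.queries then step (auxm m) ⟨m + 1, h⟩ else auxm m) = _
    rw [dif_pos h]
  have hu : ∑ s, ‖u s‖ ^ 2 = 1 := by
    simp only [u]
    rw [sum_norm_sq_mulVec_of_mem_unitaryGroup (A.unitaries 0).2, Finset.sum_eq_single A.start]
    · simp
    · intro s _ hs; simp [hs]
    · simp
  have hu1 : ∑ s, ‖u1 s‖ ^ 2 ≤ 1 := by
    simp only [u1]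
    rw [sum_norm_sq_mulVec_of_mem_unitaryGroup (A.unitaries _).2, ← hu,
      ← sum_norm_sq_blockDiff_add_blockPlus u]
    have : 0 ≤ ∑ k, ∑ s, ‖blockDiff k u s‖ ^ 2 :=
      Finset.sum_nonneg fun k _ => Finset.sum_nonneg fun s _ => by positivity
    linarith
  -- the invariant
  let P : ℕ → ((Fin N → Bool) → Fin N × Bool × A.W → ℂ) → Prop := fun j Ψ =>
    (∀ S : Finset (Fin N), j < S.card → vfc Ψ S = 0) ∧ (j = 0 → Ψ = init) ∧
    (1 ≤ j →
      (∀ S : Finset (Fin N), j - 1 < S.card → vfc (auxm (j - 1)) S = 0) ∧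
      (∑ R ∈ Finset.univ.filter (fun R : Finset (Fin N) => R.card = T₂ - j),
          ∑ s, ‖gam c T₂ Ψ R s‖ ^ 2) +
        (∑ R ∈ Finset.univ.filter (fun R : Finset (Fin N) => R.card = T₂ - j + 1),
          ∑ s, ‖(gam c T₂ Ψ R - gam c T₂ (auxm (j - 1)) R) s‖ ^ 2) ≤ 1 ∧
      (∑ R ∈ Finset.univ.filter (fun R : Finset (Fin N) => R.card = T₂ - j + 1),
          ∑ k ∈ R, ∑ s, ‖blockDiff k (gam c T₂ (auxm (j - 1)) R) s‖ ^ 2 ≤ 1) ∧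
      (2 ≤ j → ∑ R ∈ Finset.univ.filter (fun R : Finset (Fin N) => R.card = T₂ - j + 1),
          ∑ s, ‖gam c T₂ (auxm (j - 1)) R s‖ ^ 2 ≤ 1))
  have h0 : P 0 init := ⟨level_mulVec (level_const _) _, fun _ => rfl, fun h => absurd h (by norm_num)⟩
  have hstep : ∀ (j : Fin A.queries) (Ψ : (Fin N → Bool) → Fin N × Bool × A.W → ℂ),
      P j Ψ → P (j + 1) (step Ψ j) := by
    rintro ⟨j, hjlt⟩ Ψ ⟨hlev, hinit, hrest⟩
    refine ⟨level_mulVec (level_oracle hlev) _, fun h => absurd h (by simp), fun _ => ?_⟩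
    simp only [Nat.add_sub_cancel]
    rcases Nat.eq_zero_or_pos j with hj0 | hjpos
    · -- base: time 0 → 1
      subst hj0
      have hΨ : Ψ = init := hinit rfl
      subst hΨ
      refine ⟨?_, ?_, ?_, fun h => absurd h (by norm_num)⟩
      · intro S hS
        rw [auxm_zero]
        exact level_const _ S (by omega)
      · rw [auxm_zero]
        have hTop : ∑ R ∈ Finset.univ.filter (fun R : Finset (Fin N) => R.card = T₂ - (0 + 1)),
            ∑ s, ‖gam c T₂ (step init ⟨0, hjlt⟩) R s‖ ^ 2 ≤ 1 := by
          change ∑ R ∈ Finset.univ.filter (fun R : Finset (Fin N) => R.card = T₂ - (0 + 1)),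
            ∑ s, ‖gam c T₂ (fun b => (A.unitaries (Fin.succ ⟨0, hjlt⟩)).1 *ᵥ
              (queryOracle b *ᵥ init b)) R s‖ ^ 2 ≤ 1
          rw [sum_norm_sq_gam_step c (level_const u) (A.unitaries _).2 (by omega : T₂ - (0 + 1) + (0 + 1) = T₂),
            show T₂ - (0 + 1) + 1 = T₂ from by omega]
          exact base_bound c hc u hu
        have hD : ∑ R ∈ Finset.univ.filter (fun R : Finset (Fin N) => R.card = T₂ - (0 + 1) + 1),
            ∑ s, ‖(gam c T₂ (step init ⟨0, hjlt⟩) R - gam c T₂ (fun _ => u1) R) s‖ ^ 2 = 0 := by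
          refine Finset.sum_eq_zero fun R hR => ?_
          rw [Finset.mem_filter] at hR
          have hRc : R.card = T₂ := by omega
          have e1 : gam c T₂ (step init ⟨0, hjlt⟩) R = c R • u1 := by
            rw [gam_top c _ hRc]
            change c R • vfc (fun b => (A.unitaries (Fin.succ ⟨0, hjlt⟩)).1 *ᵥ
              (queryOracle b *ᵥ (fun _ : Fin N → Bool => u) b)) ∅ = c R • u1
            rw [vfc_step_const_empty]
          rw [e1, gam_top c _ hRc, vfc_const_empty, sub_self]
          simp
        rw [hD, add_zero]
        exact hTop
      · rw [auxm_zero, show T₂ - (0 + 1) + 1 = T₂ from by omega]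
        exact base_bound_le c hc u1 hu1
    · -- step: time j → j + 1 with j ≥ 1
      obtain ⟨hlev1, hpot, hI1, hOne⟩ := hrest hjpos
      have hauxj : auxm j = step (auxm (j - 1)) ⟨j, hjlt⟩ := by
        obtain ⟨m, rfl⟩ : ∃ m, j = m + 1 := ⟨j - 1, by omega⟩
        rw [Nat.add_sub_cancel]
        exact auxm_succ m hjlt
      have hlev1' : ∀ S : Finset (Fin N), j < S.card → vfc (auxm j) S = 0 := by
        intro S hS
        rw [hauxj]
        exact level_mulVec (level_oracle hlev1) _ S (by show j - 1 + 1 < S.card; omega)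
      -- `One_{j+1} = I¹_j ≤ 1`
      have hOne' : ∑ R ∈ Finset.univ.filter (fun R : Finset (Fin N) => R.card = T₂ - (j + 1) + 1),
          ∑ s, ‖gam c T₂ (auxm j) R s‖ ^ 2 ≤ 1 := by
        rw [hauxj]
        change ∑ R ∈ Finset.univ.filter (fun R : Finset (Fin N) => R.card = T₂ - (j + 1) + 1),
          ∑ s, ‖gam c T₂ (fun b => (A.unitaries (Fin.succ ⟨j, hjlt⟩)).1 *ᵥ
            (queryOracle b *ᵥ auxm (j - 1) b)) R s‖ ^ 2 ≤ 1
        rw [sum_norm_sq_gam_step c hlev1 (A.unitaries _).2 (by omega : T₂ - (j + 1) + 1 + (j - 1 + 1) = T₂),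
          show T₂ - (j + 1) + 1 + 1 = T₂ - j + 1 from by omega]
        exact hI1
      refine ⟨hlev1', ?_, ?_, fun _ => hOne'⟩
      · -- the potential
        rw [hauxj]
        have hp := potential_step c hjpos (by omega : j + 1 ≤ T₂) hlev hlev1 (A.unitaries (Fin.succ ⟨j, hjlt⟩)).2
          (Ψ := Ψ) (Φ := auxm (j - 1)) (T₂ := T₂)
        rw [show T₂ - (j + 1) + 1 = T₂ - j from by omega]
        exact hp.trans hpot
      · calc ∑ R ∈ Finset.univ.filter (fun R : Finset (Fin N) => R.card = T₂ - (j + 1) + 1),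
              ∑ k ∈ R, ∑ s, ‖blockDiff k (gam c T₂ (auxm j) R) s‖ ^ 2
            ≤ ∑ R ∈ Finset.univ.filter (fun R : Finset (Fin N) => R.card = T₂ - (j + 1) + 1),
              ∑ s, ‖gam c T₂ (auxm j) R s‖ ^ 2 :=
              Finset.sum_le_sum fun R _ =>
                (Finset.sum_le_sum_of_subset_of_nonneg (Finset.subset_univ R) fun k _ _ =>
                  Finset.sum_nonneg fun s _ => by positivity).trans (sum_norm_sq_blockDiff_le _)
          _ ≤ 1 := hOne'
  have key : P A.queries (Fin.foldl A.queries step init) := foldl_invariant A.queries step init P h0 hstep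
  have e : (fun x => A.finalState x) = Fin.foldl A.queries step init :=
    foldl_pi A.queries (fun (x : Fin N → Bool) (ψ : Fin N × Bool × A.W → ℂ) (j : Fin A.queries) =>
      (A.unitaries j.succ).1 *ᵥ (queryOracle x *ᵥ ψ)) (fun _ => (A.unitaries 0).1 *ᵥ Pi.single A.start 1)
  rw [e]
  obtain ⟨-, hpot, -, hOne⟩ := key.2.2 (by omega)
  have hOneT := hOne hT
  have hTT : T₂ - A.queries + 1 = A.queries := by omega
  rw [hTT] at hpot hOneT
  have hD : ∑ R ∈ Finset.univ.filter (fun R : Finset (Fin N) => R.card = A.queries),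
      ∑ s, ‖(gam c T₂ (Fin.foldl A.queries step init) R - gam c T₂ (auxm (A.queries - 1)) R) s‖ ^ 2 ≤ 1 := by
    have h0le : 0 ≤ ∑ R ∈ Finset.univ.filter (fun R : Finset (Fin N) => R.card = T₂ - A.queries),
        ∑ s, ‖gam c T₂ (Fin.foldl A.queries step init) R s‖ ^ 2 :=
      Finset.sum_nonneg fun R _ => Finset.sum_nonneg fun s _ => by positivity
    linarith
  calc ∑ R ∈ Finset.univ.filter (fun R : Finset (Fin N) => R.card = A.queries),
        ∑ s, ‖gam c T₂ (Fin.foldl A.queries step init) R s‖ ^ 2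
      ≤ ∑ R ∈ Finset.univ.filter (fun R : Finset (Fin N) => R.card = A.queries),
          (2 * ∑ s, ‖(gam c T₂ (Fin.foldl A.queries step init) R - gam c T₂ (auxm (A.queries - 1)) R) s‖ ^ 2 +
            2 * ∑ s, ‖gam c T₂ (auxm (A.queries - 1)) R s‖ ^ 2) :=
        Finset.sum_le_sum fun R _ => sum_norm_sq_le_two_mul _ _
    _ ≤ 4 := by
        rw [Finset.sum_add_distrib, ← Finset.mul_sum, ← Finset.mul_sum]
        linarith


end Summit.QuantumAdvantage.QuantumAdvantage.Theorems.SosSandwich.QueryTopLevel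

end
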